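import Mathlib
import Summits.Ventures.HodgeRepro2.Tier7.Line3.LevelTowerTopology
import Summits.Ventures.HodgeRepro2.Tier7.Line3.AdicCompletionLocalField

/-!
# Tier7/Line3/AdicCompletionLevel — the level tower on Mathlib's local field is the principal congruence tower
(seat t7-x1, gen 4; the (β) normalisation row — crit-2's record (a) of STATUS l. 15803 typed)

LINE 3 (t7-plan-3), version (ii). The level-place chain (CongruenceSubgroup p694858, LevelTowerTopology p696895,
ConcreteLevelFactor p698828, AdicCompletionLocalField p703140) uses a FREE real `q > 1` and the tower
`levelTower normAbv _ hq N = {g : ‖g − 1‖ ≤ q⁻¹ ^ (N+1)}` (entrywise). On Mathlib's completion `F := v.adicCompletion K`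
of a number field `K` at the finite place `v` this module fixes `q` and reads the level:

* `q v := absNorm v.asIdeal` (`q_eq_card : q v = Nat.card (𝓞 K ⧸ v.asIdeal)`, `one_lt_q`), and Mathlib's norm on `F` is the
  NORMALISED absolute value for this `q`: `toNNReal_exp` / `norm_le_pow_iff : ‖x‖ ≤ (q v)⁻¹ ^ n ↔ Valued.v x ≤ exp (−n)`
  (`NumberField.FinitePlace.norm_def` + `WithZeroMulInt.toNNReal_strictMono`), `norm_uniformizer : ‖ϖ‖ = (q v)⁻¹` for a
  uniformiser `ϖ` of `K` at `v` (`valuation_exists_uniformizer`);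
* `mem_levelTower_iff`: `g ∈ levelTower normAbv isNonarchimedean_normAbv (one_lt_q v) N ↔ ∀ i j, Valued.v ((g − 1) i j) ≤
  exp (−(N+1))` — the level-`N` subgroup of the chain at `q := q v` IS the principal congruence subgroup of level `𝔭_v^(N+1)`
  in valuation form;
* `valued_coe_le_pow_iff : Valued.v (x : F) ≤ exp (−n) ↔ x ∈ v.asIdeal ^ n` for a global integer `x : 𝓞 K`
  (`valuedAdicCompletion_eq_valuation`, `intValuation_le_pow_iff_dvd`, `Ideal.dvd_iff_le`), so on matrices with global
  integral entries the level reads literally «`g ≡ 1 (mod 𝔭_v^(N+1))`» (`mem_levelTower_iff_of_integral`).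

WHAT THIS CHANGES IN THE [W] COLUMN: «`q > 1` free; the real `K_N` = these congruence subgroups with the level read off
`q`» (crit-2 l. 15803 (a)) becomes «`q := q v` the residue cardinality; `levelTower N` = the principal congruence subgroup of
level `𝔭_v^(N+1)`» in the kernel; KappaDataFinLocal's `abv ((k−1) i j) ≤ q⁻¹^N` reads the level off the same `q`.
DICTIONARY (in words): `K := E`, `v := w` the place above the inert `v₁` (as in AdicCompletionLocalField). Nothing here is
about (N), (P), the real `X`, or HC_CM; §8(d): NO. Blind lane: Mathlib + the HodgeRepro2 prefix; no sorry;
axioms ⊆ {propext, Classical.choice, Quot.sound}.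
-/

namespace Summit.Ventures.HodgeRepro2.Tier7.Line3.AdicCompletionLevel

open IsDedekindDomain IsDedekindDomain.HeightOneSpectrum NumberField WithZeroMulInt WithZero
  Summit.Ventures.HodgeRepro2.Tier7.Line3.CongruenceSubgroup
  Summit.Ventures.HodgeRepro2.Tier7.Line3.LevelTowerTopology
open scoped NumberField WithZero NNReal

variable {K : Type*} [Field K] [NumberField K] (v : HeightOneSpectrum (𝓞 K))

/-! ## The residue cardinality -/

/-- the residue cardinality `q = N(𝔭_v) = #(𝓞 K ⧸ 𝔭_v)`, as a real number. -/
noncomputable def q : ℝ := (Ideal.absNorm v.asIdeal : ℝ)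

/-- `q v` is the cardinality of the residue field. -/
theorem q_eq_card : q v = Nat.card (𝓞 K ⧸ v.asIdeal) := by
  unfold q
  rw [Ideal.absNorm_apply, Submodule.cardQuot_apply]

/-- `1 < q v`. -/
theorem one_lt_q : 1 < q v := by
  unfold q
  exact_mod_cast NumberField.HeightOneSpectrum.one_lt_absNorm v

/-- `0 < q v`. -/
theorem q_pos : 0 < q v := zero_lt_one.trans (one_lt_q v)

/-! ## Mathlib's norm on the completion is the normalised absolute value -/

/-- `toNNReal` on an exponential. -/
theorem toNNReal_exp (a : ℤ) :
    toNNReal (NumberField.HeightOneSpectrum.absNorm_ne_zero v) (exp a) = (Ideal.absNorm v.asIdeal : ℝ≥0) ^ a := by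
  rw [toNNReal_neg_apply _ exp_ne_zero]
  congr 1

/-- the real number `(q v)⁻¹ ^ n` is `toNNReal` of `exp (−n)`. -/
theorem q_inv_pow_eq (n : ℕ) :
    (q v)⁻¹ ^ n = ((toNNReal (NumberField.HeightOneSpectrum.absNorm_ne_zero v) (exp (-(n : ℤ))) : ℝ≥0) : ℝ) := by
  rw [toNNReal_exp, zpow_neg, zpow_natCast, NNReal.coe_inv, NNReal.coe_pow, NNReal.coe_natCast, inv_pow]
  rfl

/-- **the norm of the completion against powers of `q⁻¹` is the valuation against `exp (−n)`.** -/
theorem norm_le_pow_iff (x : v.adicCompletion K) (n : ℕ) :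
    ‖x‖ ≤ (q v)⁻¹ ^ n ↔ Valued.v x ≤ exp (-(n : ℤ)) := by
  rw [FinitePlace.norm_def, q_inv_pow_eq, NNReal.coe_le_coe]
  exact (toNNReal_strictMono (NumberField.HeightOneSpectrum.one_lt_absNorm_nnreal v)).le_iff_le

/-- **a uniformiser of `K` at `v` has norm `(q v)⁻¹` in the completion**: Mathlib's norm is the normalised absolute
value. -/
theorem norm_uniformizer : ∃ π : K, v.valuation K π = exp (-1 : ℤ) ∧ ‖(π : v.adicCompletion K)‖ = (q v)⁻¹ := by
  obtain ⟨π, hπ⟩ := valuation_exists_uniformizer K v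
  refine ⟨π, hπ, ?_⟩
  rw [← FinitePlace.embedding_apply, FinitePlace.norm_embedding, NumberField.HeightOneSpectrum.adicAbv_def, hπ,
    toNNReal_exp, zpow_neg, zpow_one, NNReal.coe_inv, NNReal.coe_natCast]
  rfl

/-! ## The level tower is the principal congruence tower -/

/-- **the level tower of the chain at `q := q v` is the principal congruence tower in valuation form**:
`g ∈ K_N ↔ g − 1 ≡ 0 (mod 𝔭_v^(N+1))` entrywise. -/
theorem mem_levelTower_iff (N : ℕ) (g : GL (Fin 2) (v.adicCompletion K)) :
    g ∈ levelTower normAbv isNonarchimedean_normAbv (one_lt_q v) N ↔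
      ∀ i j, Valued.v (((g : Matrix (Fin 2) (Fin 2) (v.adicCompletion K)) - 1) i j) ≤ exp (-((N + 1 : ℕ) : ℤ)) := by
  rw [levelTower, mem_congruenceSubgroup]
  unfold EntryLE
  simp only [normAbv_apply]
  exact forall₂_congr fun i j => norm_le_pow_iff v _ (N + 1)

/-- a global integer has `Valued.v ≤ exp (−n)` in the completion iff it lies in `𝔭_v^n`. -/
theorem valued_coe_le_pow_iff (x : 𝓞 K) (n : ℕ) :
    Valued.v ((algebraMap (𝓞 K) K x : K) : v.adicCompletion K) ≤ exp (-(n : ℤ)) ↔ x ∈ v.asIdeal ^ n := by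
  rw [valuedAdicCompletion_eq_valuation', valuation_of_algebraMap, intValuation_le_pow_iff_dvd, Ideal.dvd_iff_le,
    Ideal.span_singleton_le_iff_mem]

/-- **on a matrix with global integral entries the level reads `g ≡ 1 (mod 𝔭_v^(N+1))`.** -/
theorem mem_levelTower_iff_of_integral (N : ℕ) (g : GL (Fin 2) (v.adicCompletion K))
    (m : Matrix (Fin 2) (Fin 2) (𝓞 K))
    (hm : ∀ i j, ((g : Matrix (Fin 2) (Fin 2) (v.adicCompletion K)) - 1) i j =
      ((algebraMap (𝓞 K) K (m i j) : K) : v.adicCompletion K)) :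
    g ∈ levelTower normAbv isNonarchimedean_normAbv (one_lt_q v) N ↔ ∀ i j, m i j ∈ v.asIdeal ^ (N + 1) := by
  rw [mem_levelTower_iff]
  exact forall₂_congr fun i j => by rw [hm i j, valued_coe_le_pow_iff]

end Summit.Ventures.HodgeRepro2.Tier7.Line3.AdicCompletionLevel
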